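import Summits.CriticalPhenomena.PercolationContinuityZ3.Theorems.PercNearOneGluingNoHeavyConstsLinearLowerTailAnyObserver
import HarnessLib

/-!
# (LT³⁄₂) in the low-mean regime: every instance with `κ·EN ≤ 4` (in particular `EN ≤ 6`), any relay-set size, any observer

builds on p205010 (kernel theorem, internal audit signed; external expert review pending)

PAPER-2 track "percolation constants", part (ii), seat `prim-consts-1`, gen 10 (lane index `run/shared/lean/prim/consts/CONSTANTS.md`,
row A19; memo `FROM-prim-consts-1-g10-WSI.md` §1).  Support file for the crux `NoHeavyLowerTail` (stmt-CriticalPhenomena-4575;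
`--supports`): theorems only, no definitions, no sorries, standard axioms.

The conjecture `Consts.LinearLowerTailThreeHalves`: for `0 < κ ≤ 2/3`, every finite weighted graph, relay set `A`, observer `o` and
`s ≥ max P(a ↮ a')`, `P(1 ≤ N < κ·EN) ≤ (3/2)·s` (`N = |C(o) ∩ A|`, `EN = Σ_a P(o ↔ a)`).  `…ConstsLinearLowerTailAnyObserver` proves it
for every instance with `κ·|A| ≤ 4` (`Consts.real_lowerTail_le_three_halves_of_mul_card_le_four_any`); its proof uses the hypothesis
only through `κ·EN ≤ κ·|A| ≤ 4`, i.e. through the bad event forcing `1 ≤ N ≤ 3`, which the footprint transfer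
(`Consts.lowerTail_le_blockDeficit`) and the five-point block-deficit bound (`Consts.real_blockDeficit_four_le_three_halves`, `|A| ≥ 5`)
control by `(3/2)·s`.  This file records the resulting LOW-MEAN class, which is much larger than `κ|A| ≤ 4`: the relay set may be
arbitrarily large provided the observer's EXPECTED relay count is small (`κ·EN ≤ 4`; at `κ = 2/3`: `EN ≤ 6`) — e.g. a hundred relay
points each joined to `o` with probability `≤ 0.06`.
* `Consts.real_lowerTail_le_three_halves_of_mul_mean_le_four` — `|A| ≥ 5`, `κ·EN ≤ 4` ⇒ `P(1 ≤ N < κ·EN) ≤ (3/2)·s` (any `κ`, any `s`).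
* `Consts.real_lowerTail_le_three_halves_of_mul_mean_le_four_any` — the same for every `|A|` when `0 < κ ≤ 2/3`, `s ≥ 0`
  (`|A| ≤ 4` by `Consts.real_lowerTail_le_three_halves_of_card_le_four`).
* `Consts.linearLowerTailThreeHalves_of_mul_mean_le_four`, `Consts.linearLowerTailThreeHalves_of_mean_le_six` — in the conjecture's
  quantifier shape: (LT³⁄₂) holds for every instance with `κ·EN ≤ 4`, in particular for every instance with `EN ≤ 6`.
Together with `…AnyObserver` (`|A| ≤ 6`), `…GluedGroups`/`…GluedFraction` (two relay points carrying `≥ κ·EN` glued mass: the regime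
where `3/2` is attained) and `…Star` (all stars), the open part of (LT³⁄₂) is: `|A| ≥ 7`, `EN > 4/κ ≥ 6`, no two relay points with a
`κ·EN`-fraction of `A` glued to them, not star-supported.
References: G. Kozma, N. Nitzan, arXiv:2401.12397 (2024), Conjecture 1 (p. 3); J. van den Berg, O. Häggström, J. Kahn,
Random Structures Algorithms 29 (2006) 417–435, Thm. 1.3 (p. 6).
-/

noncomputable section

namespace Summit.CriticalPhenomena.PercolationContinuityZ3.Theorems

open MeasureTheory Set Literature.Probability.LatticeModels Literature.Probability.Percolation
open scoped Classical

namespace Consts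

/-- **(LT³⁄₂) in the low-mean regime, `|A| ≥ 5`**: if `κ·EN ≤ 4` (`EN = Σ_{a∈A} P(o ↔ a)`) and every pair of `A` is cut with
probability `≤ s`, then `P(1 ≤ N < κ·EN) ≤ (3/2)·s` — for ANY observer and ANY relay-set size.  The bad event forces `1 ≤ N ≤ 3`;
footprint transfer (`Consts.lowerTail_le_blockDeficit`) and the five-point block-deficit bound
(`Consts.real_blockDeficit_four_le_three_halves`) do the rest. [cite: VandenbergHaggstromKahn2005, Thm. 1.3 (p. 6)] -/
theorem real_lowerTail_le_three_halves_of_mul_mean_le_four (n : ℕ) (w : Sym2 (Fin n) → unitInterval) (A : Finset (Fin n))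
    (o : Fin n) (hA : 5 ≤ A.card) {κ s : ℝ} (hκEN : κ * (∑ a ∈ A, (prodBernoulli w).real (openConn o a)) ≤ 4)
    (hrel : ∀ a ∈ A, ∀ a' ∈ A, (prodBernoulli w).real (openConn a a')ᶜ ≤ s) :
    (prodBernoulli w).real {ω : BondConfig (Fin n) | 1 ≤ (A.filter fun a => ω ∈ openConn o a).card ∧
        ((A.filter fun a => ω ∈ openConn o a).card : ℝ) < κ * (∑ a ∈ A, (prodBernoulli w).real (openConn o a))} ≤
      3 / 2 * s := by
  set μ := prodBernoulli w with hμ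
  have hAne : A.Nonempty := Finset.card_pos.1 (by omega)
  obtain ⟨a₀, ha₀⟩ := hAne
  have hs : 0 ≤ s := le_trans measureReal_nonneg (hrel a₀ ha₀ a₀ ha₀)
  have hblk : ∀ a ∈ A, μ.real {ω : BondConfig (Fin n) | (A.filter fun b => ω ∈ openConn a b).card < 4} ≤ 3 / 2 * s :=
    fun a ha => real_blockDeficit_four_le_three_halves n w A a ha hA hrel
  have htr := lowerTail_le_blockDeficit n w A o 4 (3 / 2 * s) hblk
  have hU1 : μ.real (⋃ a ∈ A, openConn o a) ≤ 1 := measureReal_le_one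
  have h32 : 3 / 2 * s * μ.real (⋃ a ∈ A, openConn o a) ≤ 3 / 2 * s := by
    have h0 : 0 ≤ 3 / 2 * s := by linarith
    nlinarith [measureReal_nonneg (μ := μ) (s := ⋃ a ∈ A, openConn o a)]
  refine le_trans (measureReal_mono ?_) (htr.trans h32)
  intro ω hω
  simp only [mem_setOf_eq] at hω ⊢
  obtain ⟨h1, hlt⟩ := hω
  refine ⟨h1, ?_⟩
  have : ((A.filter fun a => ω ∈ openConn o a).card : ℝ) < 4 := lt_of_lt_of_le hlt hκEN
  exact_mod_cast this

/-- **(LT³⁄₂) in the low-mean regime, any `|A|`**: for `0 < κ ≤ 2/3`, `s ≥ 0`, `κ·EN ≤ 4` and all pairs of `A` `≤ s`-unreliable,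
`P(1 ≤ N < κ·EN) ≤ (3/2)·s` (`|A| ≤ 4` by `Consts.real_lowerTail_le_three_halves_of_card_le_four`, else the previous theorem).
[cite: KozmaNitzan2024, Conj. 1 (p. 3)] -/
theorem real_lowerTail_le_three_halves_of_mul_mean_le_four_any (n : ℕ) (w : Sym2 (Fin n) → unitInterval) (A : Finset (Fin n))
    (o : Fin n) {κ s : ℝ} (hκ0 : 0 < κ) (hκ : κ ≤ 2 / 3) (hs : 0 ≤ s)
    (hκEN : κ * (∑ a ∈ A, (prodBernoulli w).real (openConn o a)) ≤ 4)
    (hrel : ∀ a ∈ A, ∀ a' ∈ A, (prodBernoulli w).real (openConn a a')ᶜ ≤ s) :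
    (prodBernoulli w).real {ω : BondConfig (Fin n) | 1 ≤ (A.filter fun a => ω ∈ openConn o a).card ∧
        ((A.filter fun a => ω ∈ openConn o a).card : ℝ) < κ * (∑ a ∈ A, (prodBernoulli w).real (openConn o a))} ≤
      3 / 2 * s := by
  by_cases h4 : A.card ≤ 4
  · exact real_lowerTail_le_three_halves_of_card_le_four n w A o h4 hκ0 hκ hs hrel
  · exact real_lowerTail_le_three_halves_of_mul_mean_le_four n w A o (by omega) hκEN hrel

/-- **(LT³⁄₂) for every instance with `κ·EN ≤ 4`** in the conjecture's quantifier shape (`Consts.LinearLowerTailThreeHalves`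
restricted to the low-mean regime; any observer, any relay-set size). [cite: KozmaNitzan2024, Conj. 1 (p. 3)] -/
theorem linearLowerTailThreeHalves_of_mul_mean_le_four :
    ∀ κ : ℝ, 0 < κ → κ ≤ 2 / 3 →
      ∀ (n : ℕ) (w : Sym2 (Fin n) → unitInterval) (A : Finset (Fin n)) (o : Fin n) (s : ℝ), 0 ≤ s →
        κ * (∑ a ∈ A, (prodBernoulli w).real (openConn o a)) ≤ 4 →
        (∀ a ∈ A, ∀ a' ∈ A, (prodBernoulli w).real (openConn a a')ᶜ ≤ s) →
        (prodBernoulli w).real {ω : BondConfig (Fin n) | 1 ≤ (A.filter fun a => ω ∈ openConn o a).card ∧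
            ((A.filter fun a => ω ∈ openConn o a).card : ℝ) < κ * (∑ a ∈ A, (prodBernoulli w).real (openConn o a))} ≤
          3 / 2 * s :=
  fun _ hκ0 hκ n w A o _ hs hκEN hrel => real_lowerTail_le_three_halves_of_mul_mean_le_four_any n w A o hκ0 hκ hs hκEN hrel

/-- **(LT³⁄₂) for every instance with `EN ≤ 6`** (`0 < κ ≤ 2/3` gives `κ·EN ≤ 4`): the observer's expected relay count at most six,
whatever `|A|`. [cite: KozmaNitzan2024, Conj. 1 (p. 3)] -/
theorem linearLowerTailThreeHalves_of_mean_le_six :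
    ∀ κ : ℝ, 0 < κ → κ ≤ 2 / 3 →
      ∀ (n : ℕ) (w : Sym2 (Fin n) → unitInterval) (A : Finset (Fin n)) (o : Fin n) (s : ℝ), 0 ≤ s →
        (∑ a ∈ A, (prodBernoulli w).real (openConn o a)) ≤ 6 →
        (∀ a ∈ A, ∀ a' ∈ A, (prodBernoulli w).real (openConn a a')ᶜ ≤ s) →
        (prodBernoulli w).real {ω : BondConfig (Fin n) | 1 ≤ (A.filter fun a => ω ∈ openConn o a).card ∧
            ((A.filter fun a => ω ∈ openConn o a).card : ℝ) < κ * (∑ a ∈ A, (prodBernoulli w).real (openConn o a))} ≤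
          3 / 2 * s := by
  intro κ hκ0 hκ n w A o s hs hEN hrel
  have hEN0 : 0 ≤ ∑ a ∈ A, (prodBernoulli w).real (openConn o a) := Finset.sum_nonneg fun _ _ => measureReal_nonneg
  have hκEN : κ * (∑ a ∈ A, (prodBernoulli w).real (openConn o a)) ≤ 4 := by
    calc κ * (∑ a ∈ A, (prodBernoulli w).real (openConn o a)) ≤ 2 / 3 * 6 :=
          mul_le_mul hκ hEN hEN0 (by norm_num)
      _ = 4 := by norm_num
  exact real_lowerTail_le_three_halves_of_mul_mean_le_four_any n w A o hκ0 hκ hs hκEN hrel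

end Consts

end Summit.CriticalPhenomena.PercolationContinuityZ3.Theorems
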